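import Summits.BirchSwinnertonDyer.Rank1Residual.X11b.Three.LambdaSupply
import Summits.BirchSwinnertonDyer.Rank1Residual.X11b.HalvesReceptacle
import Summits.BirchSwinnertonDyer.BirchSwinnertonDyer.Theorems.LeadingTermConsistencyStubDeficientOneOdd
import Literature.NumberTheory.GaloisRepresentations.HeckeCharacterValueFieldProofs
import Literature.NumberTheory.GaloisRepresentations.FrobeniusDivisionDensityProofs
import HarnessLib

/-!
# X11b @ `p = 3`, S28-c′ (K2a): RADICALITY of an admissible avatar value — some `3`-power of
# `r_λ(γ)` lies in `𝔎₃ = Frac-closure of R₀` (in fact in `ℚ₃ · μ_{3'}`), GLOBAL route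

HONEST FRAMING (cell `b2b-bsdres`, run/shared/lean/b2b/bsd-rank1-residual/, verbatim in every
file): the goal of the cell is to DELETE the COMBINATION-SHAPED residual classes of the
Birch–Swinnerton-Dyer formula for ALL analytic-rank `≤ 1` elliptic curves over `ℚ` — assembled
STRICTLY from published theorems — so that the rank-`≤ 1` remainder becomes exactly the
CONSTRUCTION-SHAPED classes, which are TYPED, NOT attempted. This is not "finishing BSD". Team N8/O2
(X11b at `3`: `3 ‖ N`, `r_an = 1`, `E[3]` irreducible): research route; nothing booked; NO label
changes; O2 stays OPEN; H45: S28 RE-EXPRESSES `(t)`, nothing shrinks, `Three.HsiehDescentAt₃` is the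
node of record. THEOREMS ONLY; no definition, no fact, no `sorry`.

PROVENANCE: deal #8 R8-33: (K2a) = the hypothesis `hK2a` of r1 GEN 8's `S28-SKETCH.lean`
VERBATIM, seat `b2b-bsdres-x11b3-p7` (gen. 4); GLOBAL route (r2 GEN 9 X5): ray-class finiteness,
Frobenius density, root extraction in `ℚ₃`; no local–global compatibility at `𝔭`.

## Contents

§1 `exists_pos_le_rayClassRel_top_pow` (pigeonhole with a BOUND `m ≤ #(J^𝔪/P^𝔪)`) and
`exists_pow_valueAtUniformizer_mem` (ONE `N ≥ 1` with `χ(ϖ_v)^N` in every subfield of `ℂ` containing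
the conjugates of `K`, Weil 1956 §1 via `HasInfinityType.idealPow_pow_eq_archRatio`); §2
`ringHom_apply_mem_range_algebraMap_padic` (every `K →+* ℚ̄_p` lands in `ℚ_p` when the odd `p` splits
in the quadratic `K`: `s1a_card_ringHom_padic` + `range_eval_eq_rootSet_minpoly` + normality); §3
`pow_apply_mem_range_of_isPAdicAvatarOf` (Frobenius density spreads `ψ(σ)^N ∈ ℚ_p` to all of `Γ_K`);
§4 `exists_pow_prime_pow_mem_closure_unrIntegers` (a unit `x ∈ ℚ̄_p` with `x^N ∈ ℚ_p` has
`x^{p^a} ∈ ℚ_p · μ_{p'} ⊆ 𝔎_p`, root extraction by `PadicUnits.exists_zpPow`); §5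
**`Three.exists_admissible_radical`** = (K2a) VERBATIM at `p = 3` (the pair of `Three.lambdaSupplyAt₃`).

## References

* [Weil1956] A. Weil, *On a certain type of characters…*, §1 (values of a Größencharakter).
* [NeukirchANT1999] J. Neukirch, *Algebraic Number Theory*, VI §1 Prop. (1.8), VII §6 (6.13)–(6.14).
* [Marcus2018] D. Marcus, *Number Fields*, Ch. 7 Ex. 12 (Frobenius density), Ch. 3 Thm. 25.
-/

noncomputable section

open scoped NumberField
open NumberField IsDedekindDomain Field Filter Topology Polynomial
  Literature.NumberTheory Literature.NumberTheory.GaloisRepresentations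
  Literature.NumberTheory.EllipticCurves Literature.NumberTheory.Automorphic

namespace Summit.BirchSwinnertonDyer.Rank1Residual.X11b.Three.LambdaSupply

/-! ### §1. Hecke side: one exponent `N` with `χ(ϖ_v)^N` in the field of conjugates of `K` -/

section Hecke

variable {K : Type} [Field K] [NumberField K]

/-- **Pigeonhole with a bound**: for a nonzero integral ideal `𝔞` prime to `𝔪 ≠ 0` there is
`1 ≤ m ≤ #(J^𝔪/P^𝔪)` with `𝔞^m` in the narrow ray class of `(1)` (as
`HeckeCharacter.exists_pos_rayClassRel_top_pow`, with the exponent bounded by the number of classes: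
two of `𝔞^0, …, 𝔞^C` agree). [cite: NeukirchANT1999, Ch. VI §1 Prop. (1.8)] -/
theorem exists_pos_le_rayClassRel_top_pow {𝔪 𝔞 : Ideal (𝓞 K)} (h𝔪 : 𝔪 ≠ ⊥) (h0 : 𝔞 ≠ ⊥)
    (hcop : IsCoprime 𝔞 𝔪) :
    ∃ m : ℕ, 0 < m ∧ m ≤ Nat.card (Quotient (LFunctions.rayClassSetoid 𝔪)) ∧
      LFunctions.RayClassRel 𝔪 ⊤ (𝔞 ^ m) := by
  classical
  haveI := LFunctions.finite_rayClassQuotient h𝔪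
  haveI : Fintype (Quotient (LFunctions.rayClassSetoid 𝔪)) := Fintype.ofFinite _
  set C := Nat.card (Quotient (LFunctions.rayClassSetoid 𝔪)) with hC
  let f : Fin (C + 1) → Quotient (LFunctions.rayClassSetoid 𝔪) := fun k =>
    Quotient.mk _ ⟨𝔞 ^ (k : ℕ), pow_ne_zero _ h0, hcop.pow_left⟩
  obtain ⟨i, j, hij, hfij⟩ := Fintype.exists_ne_map_eq_of_card_lt f (by
    rw [Fintype.card_fin, hC, Nat.card_eq_fintype_card]; exact Nat.lt_succ_self _)
  wlog hlt : (i : ℕ) < j generalizing i j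
  · exact this j i hij.symm hfij.symm
      (lt_of_le_of_ne (not_lt.mp hlt) fun h => hij (Fin.ext h).symm)
  have hr : LFunctions.RayClassRel 𝔪 (𝔞 ^ (j : ℕ)) (𝔞 ^ (i : ℕ)) := Quotient.exact hfij
  obtain ⟨b, c, hb, hc, hcop', hbc, hpos, heq⟩ := hr.symm
  refine ⟨j - i, Nat.sub_pos_of_lt hlt, ?_, b, c, hb, hc, hcop', hbc, hpos, ?_⟩
  · have hj : (j : ℕ) < C + 1 := j.isLt
    omega
  · rw [Ideal.mul_top]
    apply mul_right_cancel₀ (pow_ne_zero (i : ℕ) h0)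
    rw [mul_assoc, ← pow_add, Nat.sub_add_cancel hlt.le, heq]

/-- **One exponent for all places (Weil 1956 §1).** For an algebraic Hecke character `χ` of `K`
there is `N ≥ 1` such that `χ(ϖ_v)^N` lies, for EVERY finite place `v` at which `χ` is unramified,
in every subfield `F ⊆ ℂ` containing all conjugates of `K`: with a module of definition `𝔪`
supported on the ramified places, `𝔭_v^m` is in the trivial ray class for some `m ≤ C = #(J^𝔪/P^𝔪)`,
`χ̃(𝔭_v)^m` is an archimedean ratio `∏_w σ_w(b/c)^{p_w} σ̄_w(b/c)^{q_w} ∈ F`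
(`HasInfinityType.idealPow_pow_eq_archRatio`, `archRatio_mem`), and `N = C!`.
[cite: Weil1956, §1] [cite: NeukirchANT1999, Ch. VII §6 Prop. (6.13) and Cor. (6.14)] -/
theorem exists_pow_valueAtUniformizer_mem {χ : HeckeCharacter K} (hχ : χ.IsAlgebraic) :
    ∃ N : ℕ, 0 < N ∧ ∀ F : IntermediateField ℚ ℂ, (∀ (φ : K →+* ℂ) (x : K), φ x ∈ F) →
      ∀ v : HeightOneSpectrum (𝓞 K), χ.IsUnramifiedAt v → χ.valueAtUniformizer v ^ N ∈ F := by
  classical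
  obtain ⟨p, q, hinf⟩ := χ.isAlgebraic_iff_exists_hasInfinityType.mp hχ
  obtain ⟨e, hmod⟩ := χ.exists_isModulus_of_ramified
  set T := (HeckeCharacter.finite_ramifiedPlaces_holds χ).toFinset with hT
  set 𝔪 : Ideal (𝓞 K) := HeckeCharacter.modulusIdeal T e with h𝔪def
  have h𝔪 : 𝔪 ≠ ⊥ := HeckeCharacter.modulusIdeal_ne_bot T e
  set C := Nat.card (Quotient (LFunctions.rayClassSetoid 𝔪)) with hC
  refine ⟨C.factorial, Nat.factorial_pos C, fun F hF v hv => ?_⟩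
  have hvT : v ∉ T := fun h =>
    ((HeckeCharacter.finite_ramifiedPlaces_holds χ).mem_toFinset.mp h) hv
  have hcop : IsCoprime v.asIdeal 𝔪 :=
    v.isCoprime_of_not_le fun h => hvT (HeckeCharacter.modulusIdeal_le_iff.mp h)
  obtain ⟨m, hm, hmC, b, c, hb, hc, hcop', hbc, hpos, heq⟩ :=
    exists_pos_le_rayClassRel_top_pow h𝔪 v.ne_bot hcop
  have key := hinf.idealPow_pow_eq_archRatio hmod v.ne_bot hb hc hcop' hbc hpos heq
  rw [LFunctions.idealPow_asIdeal] at key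
  obtain ⟨k, hk⟩ := Nat.dvd_factorial hm hmC
  rw [hk, pow_mul, key]
  exact pow_mem (HeckeCharacter.archRatio_mem hF p q ((b : K) / c)) k

end Hecke

/-! ### §2. Embeddings of a quadratic field split at `p` land in `ℚ_p` -/

section Embedding

variable {K : Type} [Field K] [NumberField K] {p : ℕ} [Fact p.Prime]

/-- **Every embedding `K → ℚ̄_p` of a quadratic field in which the odd prime `p` splits lands in
`ℚ_p`.** One embedding `φ₀ : K → ℚ_p` exists (`s1a_card_ringHom_padic`: `#(K → ℚ_p) = 2`); for any
`ψ` and `x ∈ K`, `ψ x` is a root in `ℚ̄_p` of `minpoly_ℚ x`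
(`NumberField.Embeddings.range_eval_eq_rootSet_minpoly`), which splits in the normal extension
`K/ℚ`, so `ψ x = φ₀ y` for a root `y ∈ K` (`Polynomial.Splits.image_rootSet`).
[cite: Marcus2018, Ch. 3 Thm. 25] -/
theorem ringHom_apply_mem_range_algebraMap_padic (hK : Module.finrank ℚ K = 2) (hp2 : p ≠ 2)
    (hsplit : ((Ideal.span {(p : ℤ)}).primesOver (𝓞 K)).ncard = 2) (ψ : K →+* PadicAlgCl p)
    (x : K) : ψ x ∈ Set.range (algebraMap ℚ_[p] (PadicAlgCl p)) := by
  classical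
  haveI : Algebra.IsQuadraticExtension ℚ K := { finrank_eq_two' := hK }
  haveI : IsGalois ℚ K := inferInstance
  have hcard := Summit.BirchSwinnertonDyer.BirchSwinnertonDyer.Theorems.s1a_card_ringHom_padic hK hp2 hsplit
  obtain ⟨φ₀⟩ : Nonempty (K →+* ℚ_[p]) := Fintype.card_pos_iff.mp (by rw [hcard, hK]; exact two_pos)
  set ψ₀ : K →+* PadicAlgCl p := (algebraMap ℚ_[p] (PadicAlgCl p)).comp φ₀ with hψ₀
  have h1 : ψ x ∈ (minpoly ℚ x).rootSet (PadicAlgCl p) := by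
    rw [← NumberField.Embeddings.range_eval_eq_rootSet_minpoly K (PadicAlgCl p) x]
    exact ⟨ψ, rfl⟩
  rw [← (Normal.splits (inferInstance : Normal ℚ K) x).image_rootSet ψ₀.toRatAlgHom] at h1
  obtain ⟨y, -, hy⟩ := h1
  exact ⟨φ₀ y, hy.symm ▸ rfl⟩

end Embedding

/-! ### §3. Galois side: Frobenius density spreads `ψ(σ)^N ∈ ℚ_p` from Frobenii to `Γ_K` -/

section Density

variable {K : Type} [Field K] [NumberField K] {p : ℕ} [Fact p.Prime]

/-- `ℚ_p` is closed in `ℚ̄_p` (an isometric image of a complete space). [folklore] -/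
theorem isClosed_range_algebraMap_padicAlgCl :
    IsClosed (Set.range (algebraMap ℚ_[p] (PadicAlgCl p))) :=
  (algebraMap_isometry ℚ_[p] (PadicAlgCl p)).isClosedEmbedding.isClosed_range

/-- **Frobenius density: `ψ(σ)^N ∈ ℚ_p` on all of `Γ_K`.** If `e ∘ ψ` is the `p`-adic avatar of
the Hecke character `χ` and `ι⁻¹(χ(ϖ_v))^N ∈ ℚ_p` at every place `v ∤ p` where `χ` is unramified,
then `ψ(σ)^N ∈ ℚ_p` for every `σ ∈ Γ_K`: the `σ` with `ψ(σ)^N ∈ ℚ_p` form a closed subgroup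
containing every arithmetic Frobenius outside the finite set of places above `p` or ramified for
`χ` (`ψ(Frob_v) = ι⁻¹(χ(ϖ_v))⁻¹`), hence all of `Γ_K`
(`absoluteGaloisGroup.subgroup_eq_top_of_isClosed_of_frobenius_mem`).
[cite: Marcus2018, Ch. 7, Exercise 12 (f)] -/
theorem pow_apply_mem_range_of_isPAdicAvatarOf (ι : PadicAlgCl p ≃+* ℂ) {χ : HeckeCharacter K}
    {ψ : absoluteGaloisGroup K →ₜ* (PadicAlgCl p)ˣ}
    (h : IsPAdicAvatarOf ι χ ((FramedRep.unitsContinuousMulEquivOfUnique (Fin 1) (PadicAlgCl p) :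
      (PadicAlgCl p)ˣ →ₜ* GL (Fin 1) (PadicAlgCl p)).comp ψ))
    {N : ℕ} (hN : ∀ v : HeightOneSpectrum (𝓞 K), ((p : ℕ) : 𝓞 K) ∉ v.asIdeal → χ.IsUnramifiedAt v →
      ι.symm (χ.valueAtUniformizer v) ^ N ∈ Set.range (algebraMap ℚ_[p] (PadicAlgCl p)))
    (σ : absoluteGaloisGroup K) :
    ((ψ σ : (PadicAlgCl p)ˣ) : PadicAlgCl p) ^ N ∈ Set.range (algebraMap ℚ_[p] (PadicAlgCl p)) := by
  classical
  set S : Set (HeightOneSpectrum (𝓞 K)) :=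
    {v | ((p : ℕ) : 𝓞 K) ∈ v.asIdeal} ∪ {v | ¬ χ.IsUnramifiedAt v} with hS
  have hp0 : ((p : ℕ) : 𝓞 K) ≠ 0 := Nat.cast_ne_zero.2 (Fact.out : p.Prime).ne_zero
  have hSfin : S.Finite :=
    (HeckeCharacter.finite_setOf_mem_asIdeal hp0).union χ.finite_ramifiedPlaces_holds
  -- the subgroup `{σ | ψ(σ)^N ∈ ℚ_pˣ}`
  let U : Subgroup (PadicAlgCl p)ˣ :=
    (Units.map ((algebraMap ℚ_[p] (PadicAlgCl p) : ℚ_[p] →+* PadicAlgCl p) :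
      ℚ_[p] →* PadicAlgCl p)).range
  let H : Subgroup (absoluteGaloisGroup K) := U.comap ((powMonoidHom N).comp ψ.toMonoidHom)
  have hmemU : ∀ u : (PadicAlgCl p)ˣ, u ∈ U ↔
      (u : PadicAlgCl p) ∈ Set.range (algebraMap ℚ_[p] (PadicAlgCl p)) := by
    intro u
    constructor
    · rintro ⟨q, rfl⟩
      exact ⟨(q : ℚ_[p]), rfl⟩
    · rintro ⟨q, hq⟩
      have hq0 : q ≠ 0 := by
        rintro rfl
        rw [map_zero] at hq
        exact u.ne_zero hq.symm
      exact ⟨Units.mk0 q hq0, Units.ext hq⟩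
  have hmemH : ∀ τ, τ ∈ H ↔ ((ψ τ : (PadicAlgCl p)ˣ) : PadicAlgCl p) ^ N ∈
      Set.range (algebraMap ℚ_[p] (PadicAlgCl p)) := by
    intro τ
    rw [Subgroup.mem_comap, hmemU]
    rfl
  have hHset : (H : Set (absoluteGaloisGroup K)) =
      (fun τ => ((ψ τ : (PadicAlgCl p)ˣ) : PadicAlgCl p) ^ N) ⁻¹'
        Set.range (algebraMap ℚ_[p] (PadicAlgCl p)) := Set.ext fun τ => hmemH τ
  have hHc : IsClosed (H : Set (absoluteGaloisGroup K)) := by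
    rw [hHset]
    exact isClosed_range_algebraMap_padicAlgCl.preimage
      ((Units.continuous_val.comp ψ.continuous).pow N)
  have hH : H = ⊤ := by
    refine absoluteGaloisGroup.subgroup_eq_top_of_isClosed_of_frobenius_mem hSfin hHc ?_
    intro v hv 𝔓 h𝔓 Φ hΦ
    simp only [hS, Set.mem_union, Set.mem_setOf_eq, not_or, not_not] at hv
    have hval := ((isPAdicAvatarOf_unitsChar_iff ι χ ψ).mp h v hv.1 hv.2).2 𝔓 h𝔓 Φ hΦ
    rw [hmemH, hval, inv_pow]
    obtain ⟨q, hq⟩ := hN v hv.1 hv.2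
    exact ⟨q⁻¹, by rw [map_inv₀, hq]⟩
  have hσ : σ ∈ H := by rw [hH]; exact Subgroup.mem_top σ
  exact (hmemH σ).mp hσ

end Density

/-! ### §4. Root extraction: a unit of `ℚ̄_p` with a power in `ℚ_p` has a `p`-power in `ℚ_p·μ_{p'}` -/

section Radical

variable {p : ℕ} [Fact p.Prime]

/-- **Root extraction.** Let `x ∈ ℚ̄_p` with `‖x‖ = 1` and `x^N ∈ ℚ_p` for some `N ≥ 1`, `N = p^a N′`
with `p ∤ N′`. Then `x^{p^a} = ζ · y₀` with `y₀ ∈ ℚ_p` and `ζ` a root of unity of order dividing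
`(p-1)N′` (prime to `p`): `(x^{p^a})^{(p-1)N′} = q^{p-1}` is a principal unit of `ℚ_p`, which has a
`(p-1)N′`-th root `y₀ ∈ ℚ_p` (`PadicUnits.exists_zpPow`: `b^t`, `t = ((p-1)N′)⁻¹ ∈ ℤ_p`). Hence
`x^{p^a}`, read in `ℂ_p`, lies in the subfield generated by `R₀ = unrIntegers p`
(`mem_unrIntegers_of_pow_eq_one`, `algebraMap_coe_padicInt_mem_unrIntegers`), and is `≠ 0`.
[cite: Washington1997, §5.1] -/
theorem exists_pow_prime_pow_mem_closure_unrIntegers {x : PadicAlgCl p} (hx : ‖x‖ = 1) {N : ℕ}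
    (hN : 0 < N) (hxN : x ^ N ∈ Set.range (algebraMap ℚ_[p] (PadicAlgCl p))) :
    ∃ (a : ℕ) (u : ℂ_[p]), u ∈ Subfield.closure ((unrIntegers p : Subring ℂ_[p]) : Set ℂ_[p]) ∧
      u ≠ 0 ∧ (x : ℂ_[p]) ^ p ^ a = u := by
  have hp : p.Prime := Fact.out
  obtain ⟨a, N', hN', hNeq⟩ := Nat.exists_eq_pow_mul_and_not_dvd hN.ne' p hp.ne_one
  obtain ⟨q, hq⟩ := hxN
  set y : PadicAlgCl p := x ^ p ^ a with hy
  have hyN : y ^ N' = algebraMap ℚ_[p] (PadicAlgCl p) q := by rw [hy, ← pow_mul, ← hNeq, hq]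
  have hy1 : ‖y‖ = 1 := by rw [hy, norm_pow, hx, one_pow]
  have hq1 : ‖q‖ = 1 := by
    have := congrArg norm hyN
    rwa [norm_pow, hy1, one_pow, norm_algebraMap', eq_comm] at this
  -- `M = (p-1) N'` is prime to `p`, and `y^M = q^{p-1}` is (the image of) a principal unit
  set M : ℕ := (p - 1) * N' with hM
  have hM0 : 0 < M := Nat.mul_pos (Nat.sub_pos_of_lt hp.one_lt) (Nat.pos_of_ne_zero fun h => by
    rw [h, mul_zero] at hNeq; exact hN.ne' hNeq)
  have hpM : ¬ p ∣ M := by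
    rw [hM, hp.dvd_mul, not_or]
    refine ⟨fun h => ?_, hN'⟩
    have h2 := hp.two_le
    have := Nat.le_of_dvd (Nat.sub_pos_of_lt hp.one_lt) h
    omega
  set b : ℚ_[p] := q ^ (p - 1) with hb
  have hb1 : ‖1 - b‖ < 1 := Literature.NumberTheory.EllipticCurves.norm_one_sub_pow_sub_one_lt hq1
  have hyM : y ^ M = algebraMap ℚ_[p] (PadicAlgCl p) b := by
    rw [hM, mul_comm, pow_mul, hyN, ← map_pow]
  -- an `M`-th root `y₀ ∈ ℚ_p` of `b`
  obtain ⟨χb, -, hχb1, hχbP⟩ := PadicUnits.exists_zpPow (p := p) (F := ℚ_[p]) hb1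
  have hMunit : IsUnit (M : ℤ_[p]) := by
    rw [PadicInt.isUnit_iff]
    refine le_antisymm (PadicInt.norm_le_one _) (not_lt.mp fun hlt => hpM ?_)
    have : ‖((M : ℤ) : ℤ_[p])‖ < 1 := by simpa using hlt
    exact_mod_cast (PadicInt.norm_int_lt_one_iff_dvd (M : ℤ)).mp this
  obtain ⟨mU, hmU⟩ := hMunit
  set t : ℤ_[p] := ((mU⁻¹ : ℤ_[p]ˣ) : ℤ_[p]) with ht
  have hMt : (M : ℤ_[p]) * t = 1 := by rw [← hmU, ht, Units.mul_inv]
  set y₀ : ℚ_[p] := ((χb (Multiplicative.ofAdd t) : ℚ_[p]ˣ) : ℚ_[p]) with hy₀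
  have hy₀M : y₀ ^ M = b := by
    rw [hy₀, ← Units.val_pow_eq_pow_val, ← map_pow, ← ofAdd_nsmul, nsmul_eq_mul, hMt, hχb1]
  have hy₀1 : ‖y₀‖ ≤ 1 := by
    have h1 : ‖1 - y₀‖ < 1 := (hχbP _).trans_lt hb1
    calc ‖y₀‖ = ‖(y₀ - 1) + 1‖ := by rw [sub_add_cancel]
      _ ≤ max ‖y₀ - 1‖ ‖(1 : ℚ_[p])‖ := IsUltrametricDist.norm_add_le_max _ _
      _ ≤ 1 := max_le (by rw [norm_sub_rev]; exact h1.le) (by rw [norm_one])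
  have hy₀0 : y₀ ≠ 0 := Units.ne_zero _
  -- `ζ = y / y₀` is a root of unity of order prime to `p`
  set ζ : PadicAlgCl p := y * (algebraMap ℚ_[p] (PadicAlgCl p) y₀)⁻¹ with hζ
  have hζM : ζ ^ M = 1 := by
    rw [hζ, mul_pow, inv_pow, ← map_pow, hy₀M, ← hyM, mul_inv_cancel₀]
    exact pow_ne_zero _ (norm_pos_iff.mp (by rw [hy1]; exact one_pos))
  have hyζ : y = ζ * algebraMap ℚ_[p] (PadicAlgCl p) y₀ := by
    rw [hζ, inv_mul_cancel_right₀ ((_root_.map_ne_zero _).mpr hy₀0)]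
  refine ⟨a, (y : ℂ_[p]), ?_, ?_, ?_⟩
  · rw [hyζ, PadicComplex.coe_eq, map_mul]
    refine mul_mem (Subfield.subset_closure (mem_unrIntegers_of_pow_eq_one hM0 hpM ?_))
      (Subfield.subset_closure ?_)
    · rw [← map_pow, hζM, map_one]
    · rw [← IsScalarTower.algebraMap_apply,
        show y₀ = ((⟨y₀, hy₀1⟩ : ℤ_[p]) : ℚ_[p]) from rfl]
      exact X11b.Halves.algebraMap_coe_padicInt_mem_unrIntegers p _
  · rw [PadicComplex.coe_eq, _root_.map_ne_zero]
    exact norm_pos_iff.mp (by rw [hy1]; exact one_pos)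
  · rw [PadicComplex.coe_eq, PadicComplex.coe_eq, ← map_pow]

end Radical

end Summit.BirchSwinnertonDyer.Rank1Residual.X11b.Three.LambdaSupply

/-! ### §5. (K2a): radicality of an admissible avatar value at `p = 3` -/

namespace Summit.BirchSwinnertonDyer.Rank1Residual.X11b.Three

/-- **(K2a) RADICAL-VALUE SUPPLY** (the hypothesis `hK2a` of r1's S28 glue
`inter_subset_unrIntegers_of_supplies`, VERBATIM): for every `ι' : ℚ̄₃ ≃ ℂ`, every imaginary
quadratic `K` with `3` split, every anticyclotomic `κ` and topological generator `γ`, SOME admissible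
pair `(λ, r_λ)` (unitary, type `(1,-1)`, trivial on `𝕀_ℚ`, unramified outside `3`, avatar, factoring
through `κ`) has `r_λ(γ)^{3^a} = u` with `0 ≠ u ∈ 𝔎₃ = Frac-closure of R₀` — in fact for EVERY
admissible pair and every `σ ∈ Γ_K`, with `u ∈ ℚ₃ · μ_{3'}`. Proof: the pair of S24-a
(`Three.lambdaSupplyAt₃`); `λ` is algebraic, so ONE `N` has `λ(ϖ_v)^N` in the field of conjugates of
`K` at all unramified `v` (§1), whose image under `ι'⁻¹` is in `ℚ₃` (`3` splits, §2); Frobenius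
density gives `r_λ(σ)^N ∈ ℚ₃` (§3); root extraction (§4). GLOBAL route (r2 GEN 9 X5); no local–global
compatibility at `𝔭`. [cite: Weil1956, §1] [cite: Marcus2018, Ch. 7, Exercise 12 (f)] -/
theorem exists_admissible_radical :
    ∀ (ι' : PadicAlgCl 3 ≃+* ℂ) (K : Type) [Field K] [NumberField K] (κ : ZpExtension K 3)
      (γ : absoluteGaloisGroup K), IsImaginaryQuadratic K →
      ((Ideal.span {(3 : ℤ)}).primesOver (𝓞 K)).ncard = 2 → κ.IsAnticyclotomic → κ.IsTopGenerator γ →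
      ∃ (lam : HeckeCharacter K) (rlam : FramedGaloisRep K (PadicAlgCl 3) 1) (a : ℕ) (u : ℂ_[3]),
        lam.IsUnitary ∧ lam.HasInfinityType (fun _ ↦ (1 : ℤ)) (fun _ ↦ (-1 : ℤ)) ∧
        (∀ x : ideleGroup ℚ, lam (AdeleRing.ideleBaseChange ℚ K x) = 1) ∧
        (∀ v : HeightOneSpectrum (𝓞 K), ((3 : ℕ) : 𝓞 K) ∉ v.asIdeal → lam.IsUnramifiedAt v) ∧
        IsPAdicAvatarOf ι' lam rlam ∧ FactorsThroughZp κ rlam ∧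
        u ∈ Subfield.closure ((unrIntegers 3 : Subring ℂ_[3]) : Set ℂ_[3]) ∧ u ≠ 0 ∧
        avatarValueAt rlam γ ^ 3 ^ a = u := by
  intro ι' K _ _ κ γ hK h3 hκ _
  classical
  obtain ⟨lam, rlam, hunit, htype, hAQ, hunr, hav, hfac⟩ := lambdaSupplyAt₃ ι' K κ hK h3 hκ
  -- the currency `rlam = e ∘ ψ`
  set e := (FramedRep.unitsContinuousMulEquivOfUnique (Fin 1) (PadicAlgCl 3) :
    (PadicAlgCl 3)ˣ →ₜ* GL (Fin 1) (PadicAlgCl 3)) with he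
  set ψ : absoluteGaloisGroup K →ₜ* (PadicAlgCl 3)ˣ :=
    ((FramedRep.unitsContinuousMulEquivOfUnique (Fin 1) (PadicAlgCl 3)).symm :
      GL (Fin 1) (PadicAlgCl 3) →ₜ* (PadicAlgCl 3)ˣ).comp rlam with hψ
  have hr : e.comp ψ = rlam := LambdaSupply.comp_symm_comp_eq rlam
  have hav' : IsPAdicAvatarOf ι' lam (e.comp ψ) := by rw [hr]; exact hav
  have halg : lam.IsAlgebraic := lam.isAlgebraic_iff_exists_hasInfinityType.mpr ⟨_, _, htype⟩
  obtain ⟨N, hN, hNF⟩ := LambdaSupply.exists_pow_valueAtUniformizer_mem halg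
  -- §2: the subfield `F = ι'(ℚ₃) ⊆ ℂ` contains the conjugates of `K`
  let F₀ : Subfield ℂ := ((algebraMap ℚ_[3] (PadicAlgCl 3)).fieldRange).comap ι'.symm.toRingHom
  have hmemF₀ : ∀ z : ℂ, z ∈ F₀ ↔ ι'.symm z ∈ Set.range (algebraMap ℚ_[3] (PadicAlgCl 3)) := by
    intro z
    rw [Subfield.mem_comap, RingHom.mem_fieldRange]
    rfl
  let F : IntermediateField ℚ ℂ := F₀.toIntermediateField fun r => (hmemF₀ _).mpr
    ⟨(r : ℚ_[3]), by rw [eq_ratCast (algebraMap ℚ ℂ), map_ratCast, map_ratCast]⟩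
  have hmemF : ∀ z : ℂ, z ∈ F ↔ ι'.symm z ∈ Set.range (algebraMap ℚ_[3] (PadicAlgCl 3)) :=
    hmemF₀
  have hF : ∀ (φ : K →+* ℂ) (x : K), φ x ∈ F := fun φ x => (hmemF _).mpr
    (LambdaSupply.ringHom_apply_mem_range_algebraMap_padic hK.1 (by norm_num) h3
      ((ι'.symm : ℂ ≃+* PadicAlgCl 3).toRingHom.comp φ) x)
  have hNQ : ∀ v : HeightOneSpectrum (𝓞 K), ((3 : ℕ) : 𝓞 K) ∉ v.asIdeal → lam.IsUnramifiedAt v →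
      ι'.symm (lam.valueAtUniformizer v) ^ N ∈ Set.range (algebraMap ℚ_[3] (PadicAlgCl 3)) := by
    intro v _ hv
    have := (hmemF _).mp (hNF F hF v hv)
    rwa [map_pow] at this
  have hψN := LambdaSupply.pow_apply_mem_range_of_isPAdicAvatarOf ι' hav' hNQ γ
  -- §4: root extraction at `x = ψ γ = r_λ(γ)`
  have hx1 : ‖((ψ γ : (PadicAlgCl 3)ˣ) : PadicAlgCl 3)‖ = 1 :=
    LambdaSupply.PadicUnits.norm_apply_eq_one ψ.toMonoidHom ψ.continuous γ
  obtain ⟨a, u, hu, hu0, hpow⟩ :=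
    LambdaSupply.exists_pow_prime_pow_mem_closure_unrIntegers hx1 hN hψN
  refine ⟨lam, rlam, a, u, hunit, htype, hAQ, hunr, hav, hfac, hu, hu0, ?_⟩
  -- `avatarValueAt rlam γ = ψ γ` (the `1 × 1` determinant is the entry)
  have hval : avatarValueAt rlam γ = (((ψ γ : (PadicAlgCl 3)ˣ) : PadicAlgCl 3) : ℂ_[3]) := by
    unfold avatarValueAt
    rw [Matrix.GeneralLinearGroup.val_det_apply, Matrix.det_fin_one, ← hr]
    rfl
  rw [hval, hpow]

end Summit.BirchSwinnertonDyer.Rank1Residual.X11b.Three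

end
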